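import Summits.HodgeConjecture.HodgeConjecture.Theorems.F0P6aImgSectionRowUp
import HarnessLib

/-!
# `F0P6aImgSectionRowAssembled` — ★ RE-HOME of `Lines/F0_P6a_ImgSection.lean` (tree sha16 bfb84779d70f88f8, 943 l.), PART 3 of 4 — tree lines :589–:889
See PART 1 `Theorems/F0P6aImgSectionKill.lean` for the full ★ re-home header and the original module docstring (verbatim there).  Same namespace (every
fully-qualified name unchanged); the scopes open at the cut are re-opened below with their `variable` ∕ `open` ∕ `set_option` ∕ `universe` lines replayed verbatim
from the tree, in order; the code after the replay block is the tree bytes :589–:889, untouched.  HC_CM is proved only modulo the 7 printed citations (2 remaining: hLiu418 = stmt-HodgeConjecture-24832, h413 = stmt-HodgeConjecture-24833) until rung 0 closes; a re-home is count-neutral.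
-/

-- ── replay of the scopes open at tree line :589 (verbatim) ──
set_option autoImplicit false
set_option linter.dupNamespace false
noncomputable section
namespace Summit.HodgeConjecture.HodgeConjecture.Cruxes.HLiu418.F0P6aLineSpecialisation
open CategoryTheory CategoryTheory.Limits NumberField IsDedekindDomain MulAction AlgebraicGeometry
open scoped Matrix Polynomial Pointwise MonoidalCategory
open Literature.NumberTheory.GaloisRepresentations
open Literature.NumberTheory.Automorphic Literature.NumberTheory.Automorphic.UnitaryGroup
open Literature.AlgebraicGeometry.ShimuraVarieties.UnitaryCanonicalModel
open Literature.NumberTheory.Automorphic.Liu2021.AppendixC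
open Literature.AlgebraicGeometry.Motives (AlgPoints IntegralModel SchemeOver thickening thickeningGalAction thickeningLift specOver extendPoint
  specValuationSubring specFractionFieldι specRingHomι)
open Literature.NumberTheory.DiophantineGeometry (geomResidueField specialFibreFunctor specResidueField geomClosedPointIsoSpecResidueField
  geomResidueFieldEquiv toClosureValuationSubring)
open Literature.AlgebraicGeometry.RelativeSpec (ActionOver)
open Literature.NumberTheory.EllipticCurves (genericFibre specGenericPoint)
open Literature.AlgebraicGeometry.AbelianSchemes Literature.AlgebraicGeometry.AbelianSchemes.AbelianSchemeOver
open Literature.AlgebraicGeometry.GroupSchemes.AffineGroupScheme (Alg)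
open Summit.HodgeConjecture.HodgeConjecture.Cruxes.HLiu418.F0P6aModuliDatumDefs
open Summit.HodgeConjecture.HodgeConjecture.Cruxes.HLiu418.F0P6aRGDAssembly
open Summit.HodgeConjecture.HodgeConjecture.Cruxes.HLiu418.F0P6aDatumOfInputs
section ImgRowUp
set_option synthInstance.maxHeartbeats 100000
open Literature.AlgebraicGeometry.GroupSchemes (GroupSchemeKernel.ker GroupSchemeKernel.kerι)
open Literature.AlgebraicGeometry.GroupSchemes.AffineGroupScheme (quotIncl ptEquiv)
open Literature.AlgebraicGeometry.GroupSchemes.EtaleHomOfPoints (exists_hom_comp_quotIncl_comp_eq_of_points)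
variable {F : Type} [Field F] [NumberField F] [IsCMField F] {ι₁ : F →+* ℂ}
    {Jstar : Matrix (Fin 2) (Fin 2) F}
    {K₀ : C5.OpenCompactSubgroup ↥(finAdelic ↥(maximalRealSubfield F) F (IsCMField.complexConj F) 2 Jstar)}
    {S : RecordSystemGS F Jstar ι₁ K₀} {hU7ₛ : S.HeckeTranslateDefinedOver}
    {hJ : (Jstar.map (IsCMField.complexConj F))ᵀ = Jstar} {hJu : IsUnit Jstar}
    {Fi : Type} [Field Fi] [Algebra F Fi] {Kc : C5.SmallLevel K₀} {G : Type} [Group G]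
    {𝓜 : IntegralModel (𝓞 F) F ((thickening F Fi).obj (S.M.obj Kc))}
    {w : HeightOneSpectrum (𝓞 F)} {hw : (IsCMField.complexConj F) • w ≠ w} {h𝓨 : (𝓜.localise w).IsSmoothProper 1}
    {θ : ActionOver (𝓜.localise w).total.hom ((Fi ≃ₐ[F] Fi) × G)}
    {e : Fi →ₐ[F] AlgebraicClosure (w.adicCompletion F)}
variable (I : RGDInputsAt F ι₁ Jstar K₀ S hU7ₛ hJ hJu Fi Kc G 𝓜 w hw h𝓨 θ e)

set_option maxHeartbeats 400000 in
open scoped MonObj CategoryTheory.Obj in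
set_option backward.isDefEq.respectTransparency false in
/-- **(T1-LS) `V(J) ↪ layerR I y″ ↪ famOf I y″ —(ψ_P ×_𝓨 ỹ″)→ (univ ⊗ 𝔟) ×_𝓨 ỹ″` IS A CLOSED IMMERSION** for EVERY ideal `J ⊆ Γ(layerR I y″)` and the Serre letters
`(E′, P, Q)` of `𝔭_w` (the `hclosed` binder of `himg_spGeoOf_of_imgLine` at `cR := baseChangeHom (serreTranslate I.act E' hE' P) (liftOf … y″).left`, with
`liftOf … y″ = extendPoint … (modelPointsEquiv.symm (ℓ_e y″))` by `rfl`; take `J := (eL Lb)^sat`).  `quotIncl ≫ ιR` is a closed immersion (★ `isClosedImmersion_quotIncl_left`,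
★ (S-c) `isClosedImmersion_kerι_serreTranslate_left`) KILLED BY `𝔭_{c•w}` (the kernel-of-`𝔭_{c•w}` clause of `ιR`, ★ (S-c) `exists_comp_kerι_eq_iff_forall_mem`); `ψ_P` is
finite (★ `isFinite_serreTranslate_left` from the quasi-inverse row `Q`); `𝔭_w + 𝔭_{c•w} = 𝒪` (`hw`); conclude by ★ p851208
`isClosedImmersion_comp_baseChangeHom_serreTranslate_left` (the model return map `g_a`, `a ∈ 𝔭_w`, `a + b = 1`, `b ∈ 𝔭_{c•w}`, fixes the sub-pin; finite mono).
[cite: GortzWedhorn2020, Cor. 12.92 and Prop. 12.94] [cite: Conrad2004GrossZagier, §7 (Thm. 7.5)] [cite: Tate1997FiniteFlatGroupSchemes, (1.6)–(1.7) p. 122] -/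
theorem isClosedImmersion_quotIncl_ιR_comp_coverR (y'' : AlgPoints (S.M.obj Kc) (AlgebraicClosure (w.adicCompletion F)))
    (J : Ideal (Alg (layerR I y'')))
    -- the Serre letters of `𝔭_w` (the (ρ1𝒞) socket's, VERBATIM)
    {m : ℕ} (E' : Matrix (Fin m) (Fin m) (𝓞 F)) (hE' : E' * E' = E') (P : Matrix (Fin m) (Fin 1) (𝓞 F)) (Q : Matrix (Fin 1) (Fin m) (𝓞 F))
    (hP : E' * P = P) (hQ : Q * E' = Q) (hQP : Q * P = Matrix.scalar (Fin 1) (I.pChar : 𝓞 F))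
    (hPQ : P * Q = Matrix.scalar (Fin m) (I.pChar : 𝓞 F) * E') (h𝔭 : Ideal.span (Set.range fun k => P k 0) = w.asIdeal) :
    haveI := I.comm
    haveI := isMonHom_transR I y''
    haveI := isAffine_layerR_left I y''
    IsClosedImmersion ((quotIncl (layerR I y'') J ≫ ιR I y'') ≫ baseChangeHom (serreTranslate I.act E' hE' P) (liftOf S Kc 𝓜 w h𝓨 e y'').left).left := by
  haveI := I.comm
  haveI := isMonHom_transR I y''
  haveI := isAffine_layerR_left I y''
  haveI := isCommMonObj_famOf I y''
  -- the sub-pin `V(J) ↪ layerR ↪ famOf` is a closed immersion …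
  haveI : IsClosedImmersion (quotIncl (layerR I y'') J ≫ ιR I y'').left := by
    haveI := Literature.AlgebraicGeometry.GroupSchemes.AffineGroupScheme.isClosedImmersion_quotIncl_left (layerR I y'') J
    haveI : IsClosedImmersion (ιR I y'').left :=
      IdealTorsion.isClosedImmersion_kerι_serreTranslate_left (actFamOf I y'') (EOf w) (EOf_idem w) (POf w)
    rw [Over.comp_left]
    infer_instance
  -- … killed by `𝔭_{c•w}` (kernel-of-`𝔭_{c•w}` clause of `ιR`)
  have hζ : ∀ x ∈ ((IsCMField.complexConj F) • w).asIdeal, (quotIncl (layerR I y'') J ≫ ιR I y'') ≫ (actFamOf I y'').i x = 1 :=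
    (IdealTorsion.exists_comp_kerι_eq_iff_forall_mem (actFamOf I y'') (EOf w) (EOf_idem w) (POf w) (pres_laws w).2.1 (pres_laws w).2.2.2.2.2
      (quotIncl (layerR I y'') J ≫ ιR I y'')).1 ⟨quotIncl (layerR I y'') J, rfl⟩
  -- `ψ_P` is finite (quasi-inverse row `Q`, `p ≠ 0`)
  haveI := isFinite_serreTranslate_left I.act E' hE' P Q I.hpChar.1.ne_zero hP hQ hQP hPQ
  -- `𝔭_w + 𝔭_{c•w} = 𝒪_F`
  have hne : w.asIdeal ≠ ((IsCMField.complexConj F) • w).asIdeal := fun h => hw (HeightOneSpectrum.ext h.symm)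
  have h𝔭𝔡 : Ideal.span (Set.range fun k => P k 0) ⊔ ((IsCMField.complexConj F) • w).asIdeal = ⊤ := by
    rw [h𝔭]; exact Ideal.IsMaximal.coprime_of_ne w.isMaximal ((IsCMField.complexConj F) • w).isMaximal hne
  -- ★ p851208 at the model cover (`actFamOf I y'' = I.act.baseChange ỹ″`, an `abbrev`)
  exact isClosedImmersion_comp_baseChangeHom_serreTranslate_left (liftOf S Kc 𝓜 w h𝓨 e y'').left I.act E' hE' P hP h𝔭𝔡
    (quotIncl (layerR I y'') J ≫ ιR I y'') hζ

end ImgRowUp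

/-! ## § IMG — THE ASSEMBLED HEAD -/

section ImgRowAssembled

set_option synthInstance.maxHeartbeats 100000

open Literature.AlgebraicGeometry.GroupSchemes (GroupSchemeKernel.ker GroupSchemeKernel.kerι)
open Literature.AlgebraicGeometry.GroupSchemes.AffineGroupScheme (quotIncl ptEquiv algBaseChangeEquiv)

-- the frame of the D-line՚s `Letters` section VERBATIM
variable {F : Type} [Field F] [NumberField F] [IsCMField F] {ι₁ : F →+* ℂ}
    {Jstar : Matrix (Fin 2) (Fin 2) F}
    {K₀ : C5.OpenCompactSubgroup ↥(finAdelic ↥(maximalRealSubfield F) F (IsCMField.complexConj F) 2 Jstar)}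
    {S : RecordSystemGS F Jstar ι₁ K₀} {hU7ₛ : S.HeckeTranslateDefinedOver}
    {hJ : (Jstar.map (IsCMField.complexConj F))ᵀ = Jstar} {hJu : IsUnit Jstar}
    {Fi : Type} [Field Fi] [Algebra F Fi] {Kc : C5.SmallLevel K₀} {G : Type} [Group G]
    {𝓜 : IntegralModel (𝓞 F) F ((thickening F Fi).obj (S.M.obj Kc))}
    {w : HeightOneSpectrum (𝓞 F)} {hw : (IsCMField.complexConj F) • w ≠ w} {h𝓨 : (𝓜.localise w).IsSmoothProper 1}
    {θ : ActionOver (𝓜.localise w).total.hom ((Fi ≃ₐ[F] Fi) × G)}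
    {e : Fi →ₐ[F] AlgebraicClosure (w.adicCompletion F)}

variable (I : RGDInputsAt F ι₁ Jstar K₀ S hU7ₛ hJ hJu Fi Kc G 𝓜 w hw h𝓨 θ e)

set_option maxHeartbeats 400000 in
open scoped MonObj CategoryTheory.Obj in
set_option backward.isDefEq.respectTransparency false in
/-- **§ IMG ASSEMBLED modulo (F1)** (the edition that elaborates on the served LS ED. 2 olean: the (F1) identifications `hσΩ hσκ hσΩ'' hσκ''` stay binders;
on ED. 3 they are `iso…Of_inv_eq_fibreAlongIso`, cf. `himg_spGeoOf_of_roofRows`).  **(ρ1𝒞) (IMG) ROW `himg` AT `H″ := spGeoOf I 𝔡 y″ Lb` FROM THE ROOF ROWS, THE SERRE LETTERS, § Jφ's LINE AND THE (IMG-gen) ROW OF THE REDUCED LEG.**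
For the roof legs `A_y —q→ B ←c— A_{y″}` with (r2) `Ker c(Ω̄) = A_{y″}[𝔭_w]`, `c` onto on points, (r4) common intertwiners; the Serre letters `(E′, P, Q)` of `𝔭_w`; the image line
`Lb : LineOf I y″` with § Jφ's membership law `hLb`; ANY reduced leg `ψ : A_{x̄} → M` and cover `cbar : A_{x̄″} → M` carrying the (IMG-gen) row `hIMG` of ★
`exists_roofLeg_specialFibre_of_downstairsDual_kerRows_image` for `(q, c)` ((b″) text, closed-immersion instance at the MODEL cover `ψ_P ×_𝓨 ỹ″`): for every `T`-point
`t` of the dock `G₀(x̄)` there is `s : T → V(H″)` with `s ≫ V(H″) ↪ G₀(x̄″) ↪ A_{x̄″} —cbar→ = t ≫ G₀(x̄) ↪ A_{x̄} —ψ→`.  = g36's `himg_spGeoOf_of_imgLine` with (F1) by LS ED. 3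
`iso…Of_inv_eq_fibreAlongIso`, `himgΩ` by (U1″) `exists_layerΩ_hom_of_roofRows`, `hclosed` by (T1-LS) `isClosedImmersion_quotIncl_ιR_comp_coverR`.
[cite: Liu2021, Prop. D.8 (1)(2) p. 135, p. 137] [cite: SerreTate1968, §1 Lemma 2] [cite: EGAIV2, Prop. 2.8.5] [cite: Tate1997FiniteFlatGroupSchemes, (3.7)]
[cite: GortzWedhorn2020, Cor. 12.92 and Prop. 12.94] -/
theorem himg_spGeoOf_of_roofRows_of_sigma [ExpChar (geomResidueField w) I.pChar] (𝔡 : ∀ xbar, DockAt I xbar)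
    (y y'' : AlgPoints (S.M.obj Kc) (AlgebraicClosure (w.adicCompletion F))) (Lb : LineOf I y'')
    {B : AbelianSchemeOver (Spec (.of (AlgebraicClosure (w.adicCompletion F))))}
    (q : (schΩOf S Kc 𝓜 w e I.univ y).X ⟶ B.X) [IsMonHom q] (c : (schΩOf S Kc 𝓜 w e I.univ y'').X ⟶ B.X) [IsMonHom c]
    -- downstairs: `ψ` the reduced leg and `cbar` (in (ρ1𝒞): `c̄_{x̄″}`) into ANY `M`
    {M : SchemeOver (geomResidueField w)}
    (ψ : (sch₀Of 𝓜 w I.univ (red₀Of S Kc 𝓜 w h𝓨 e y)).X ⟶ M) (cbar : (sch₀Of 𝓜 w I.univ (red₀Of S Kc 𝓜 w h𝓨 e y'')).X ⟶ M)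
    -- the Serre letters of `𝔭_w` (the (ρ1𝒞) socket's, VERBATIM)
    {m : ℕ} (E' : Matrix (Fin m) (Fin m) (𝓞 F)) (hE' : E' * E' = E') (P : Matrix (Fin m) (Fin 1) (𝓞 F)) (Q : Matrix (Fin 1) (Fin m) (𝓞 F))
    (hP : E' * P = P) (hQ : Q * E' = Q) (hQP : Q * P = Matrix.scalar (Fin 1) (I.pChar : 𝓞 F))
    (hPQ : P * Q = Matrix.scalar (Fin m) (I.pChar : 𝓞 F) * E') (h𝔭 : Ideal.span (Set.range fun k => P k 0) = w.asIdeal)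
    -- § Jφ's membership law (B-p08 `mem_imgLineOfRoof_iff` text)
    (hLb : ∀ P'' : (fibreΩOf S Kc 𝓜 w e I.univ y'').Points (AlgebraicClosure (w.adicCompletion F)),
      P'' ∈ Lb.1 ↔
        IsIdealTorsionΩ S Kc 𝓜 w e I.univ I.act y'' ((IsCMField.complexConj F) • w).asIdeal P'' ∧
          ∃ P : (fibreΩOf S Kc 𝓜 w e I.univ y).Points (AlgebraicClosure (w.adicCompletion F)),
            IsIdealTorsionΩ S Kc 𝓜 w e I.univ I.act y ((IsCMField.complexConj F) • w).asIdeal P ∧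
              (AlgPoints.map c P'' : B.toAffine.toAbelianVariety.Points (AlgebraicClosure (w.adicCompletion F))) = AlgPoints.map q P)
    -- (r2) `Ker c(Ω̄) = A_{y″}[𝔭_w]` (the legs' `hr2` text)
    (h2 : ∀ P : (fibreΩOf S Kc 𝓜 w e I.univ y'').Points (AlgebraicClosure (w.adicCompletion F)),
      (AlgPoints.map c P : B.toAffine.toAbelianVariety.Points (AlgebraicClosure (w.adicCompletion F))) = 1 ↔
        IsIdealTorsionΩ S Kc 𝓜 w e I.univ I.act y'' w.asIdeal P)
    -- `c` is onto on points
    (h2s : Function.Surjective c.left.base)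
    -- (r4) common intertwiners of the legs (the legs' `hr4` text)
    (h4 : ∀ a : 𝓞 F, ∃ b : B.X ⟶ B.X,
      (actΩOf S Kc 𝓜 w e I.univ I.act a y).hom.hom.hom ≫ q = q ≫ b ∧ (actΩOf S Kc 𝓜 w e I.univ I.act a y'').hom.hom.hom ≫ c = c ≫ b)
    -- (F1) at `y` and `y″` (KILL engine binder texts VERBATIM; on LS ED. 3: `iso…Of_inv_eq_fibreAlongIso`, see `himg_spGeoOf_of_roofRows`)
    (hσΩ : (isoGenericOf I y).inv =
      (I.univ.fibreBaseChangeIso ((𝓜.localise w).genericIso'.inv.left ≫ pullback.fst (𝓜.localise w).total.hom (specGenericPoint (HeightOneSpectrum.valuationSubringAtPrime F w) F))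
          (thickeningLift e (S.M.obj Kc) y).left ≪≫
        I.univ.fibreCongrPtIso (left_thickeningLift_comp_genericι_eq S Kc 𝓜 w h𝓨 e y) ≪≫
        (I.univ.fibreBaseChangeIso (liftOf S Kc 𝓜 w h𝓨 e y).left (sΩ w)).symm).inv.hom.hom.hom)
    (hσκ : (isoSpecialOf I y).inv =
      (I.univ.fibreBaseChangeIso (pullback.fst (𝓜.localise w).total.hom (specResidueField w)) (red₀Of S Kc 𝓜 w h𝓨 e y).left ≪≫
        I.univ.fibreCongrPtIso (left_red₀Of_comp_specialι_eq S Kc 𝓜 w h𝓨 e y) ≪≫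
        (I.univ.fibreBaseChangeIso (liftOf S Kc 𝓜 w h𝓨 e y).left (sκ w)).symm).inv.hom.hom.hom)
    (hσΩ'' : (isoGenericOf I y'').inv =
      (I.univ.fibreBaseChangeIso ((𝓜.localise w).genericIso'.inv.left ≫ pullback.fst (𝓜.localise w).total.hom (specGenericPoint (HeightOneSpectrum.valuationSubringAtPrime F w) F))
          (thickeningLift e (S.M.obj Kc) y'').left ≪≫
        I.univ.fibreCongrPtIso (left_thickeningLift_comp_genericι_eq S Kc 𝓜 w h𝓨 e y'') ≪≫
        (I.univ.fibreBaseChangeIso (liftOf S Kc 𝓜 w h𝓨 e y'').left (sΩ w)).symm).inv.hom.hom.hom)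
    (hσκ'' : (isoSpecialOf I y'').inv =
      (I.univ.fibreBaseChangeIso (pullback.fst (𝓜.localise w).total.hom (specResidueField w)) (red₀Of S Kc 𝓜 w h𝓨 e y'').left ≪≫
        I.univ.fibreCongrPtIso (left_red₀Of_comp_specialι_eq S Kc 𝓜 w h𝓨 e y'') ≪≫
        (I.univ.fibreBaseChangeIso (liftOf S Kc 𝓜 w h𝓨 e y'').left (sκ w)).symm).inv.hom.hom.hom)
    -- the (IMG-gen) row of ★ `exists_roofLeg_specialFibre_of_downstairsDual_kerRows_image` for `ψ` ((b″) `exists_roofLeg_of_legs_kerRows_image` last conjunct, TOKEN FOR TOKEN)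
    (hIMG : haveI := I.comm; haveI : IsProper (𝓜.localise w).total.hom := h𝓨.2
      (∀ (𝒦 : Over (Spec (.of (closureValuationSubring (w.adicCompletion F))))) (incl : 𝒦 ⟶ (I.univ.baseChange (extendPoint (closureValuationSubring (w.adicCompletion F)) (toClosureValuationSubring w) (𝓜.localise w).total ((𝓜.localise w).modelPointsEquiv.symm (thickeningLift e (S.M.obj Kc) y))).left).X) [Flat 𝒦.hom]
        (𝒵 : Over (Spec (.of (closureValuationSubring (w.adicCompletion F))))) (ζ : 𝒵 ⟶ (I.univ.baseChange (extendPoint (closureValuationSubring (w.adicCompletion F)) (toClosureValuationSubring w) (𝓜.localise w).total ((𝓜.localise w).modelPointsEquiv.symm (thickeningLift e (S.M.obj Kc) y''))).left).X) [IsClosedImmersion (ζ ≫ baseChangeHom (serreTranslate I.act E' hE' P) (extendPoint (closureValuationSubring (w.adicCompletion F)) (toClosureValuationSubring w) (𝓜.localise w).total ((𝓜.localise w).modelPointsEquiv.symm (thickeningLift e (S.M.obj Kc) y''))).left).left],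
        (∃ m : (Over.pullback (specFractionFieldι (closureValuationSubring (w.adicCompletion F)) (toClosureValuationSubring w)).left).obj 𝒦 ⟶ (Over.pullback (specFractionFieldι (closureValuationSubring (w.adicCompletion F)) (toClosureValuationSubring w)).left).obj 𝒵,
          m ≫ (((Over.pullback (specFractionFieldι (closureValuationSubring (w.adicCompletion F)) (toClosureValuationSubring w)).left).map ζ ≫ (I.univ.fibreBaseChangeIso ((𝓜.localise w).genericIso'.inv.left ≫ pullback.fst (𝓜.localise w).total.hom (specGenericPoint (HeightOneSpectrum.valuationSubringAtPrime F w) F)) (thickeningLift e (S.M.obj Kc) y'').left ≪≫ I.univ.fibreCongrPtIso ((𝓜.localise w).left_specFractionFieldι_comp_extendPoint_modelPointsEquiv_symm (thickeningLift e (S.M.obj Kc) y'')).symm ≪≫ (I.univ.fibreBaseChangeIso (extendPoint (closureValuationSubring (w.adicCompletion F)) (toClosureValuationSubring w) (𝓜.localise w).total ((𝓜.localise w).modelPointsEquiv.symm (thickeningLift e (S.M.obj Kc) y''))).left (specFractionFieldι (closureValuationSubring (w.adicCompletion F)) (toClosureValuationSubring w)).left).symm).inv.hom.hom.hom) ≫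 c) =
            ((Over.pullback (specFractionFieldι (closureValuationSubring (w.adicCompletion F)) (toClosureValuationSubring w)).left).map incl ≫ (I.univ.fibreBaseChangeIso ((𝓜.localise w).genericIso'.inv.left ≫ pullback.fst (𝓜.localise w).total.hom (specGenericPoint (HeightOneSpectrum.valuationSubringAtPrime F w) F)) (thickeningLift e (S.M.obj Kc) y).left ≪≫ I.univ.fibreCongrPtIso ((𝓜.localise w).left_specFractionFieldι_comp_extendPoint_modelPointsEquiv_symm (thickeningLift e (S.M.obj Kc) y)).symm ≪≫ (I.univ.fibreBaseChangeIso (extendPoint (closureValuationSubring (w.adicCompletion F)) (toClosureValuationSubring w) (𝓜.localise w).total ((𝓜.localise w).modelPointsEquiv.symm (thickeningLift e (S.M.obj Kc) y))).left (specFractionFieldι (closureValuationSubring (w.adicCompletion F)) (toClosureValuationSubring w)).left).symm).inv.hom.hom.hom) ≫ q) →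
        ∃ m : (Over.pullback ((geomClosedPointIsoSpecResidueField w).inv.left ≫ (specRingHomι (closureValuationSubring (w.adicCompletion F)) (toClosureValuationSubring w) (IsLocalRing.residue (closureValuationSubring (w.adicCompletion F)))).left)).obj 𝒦 ⟶ (Over.pullback ((geomClosedPointIsoSpecResidueField w).inv.left ≫ (specRingHomι (closureValuationSubring (w.adicCompletion F)) (toClosureValuationSubring w) (IsLocalRing.residue (closureValuationSubring (w.adicCompletion F)))).left)).obj 𝒵,
          m ≫ (((Over.pullback ((geomClosedPointIsoSpecResidueField w).inv.left ≫ (specRingHomι (closureValuationSubring (w.adicCompletion F)) (toClosureValuationSubring w) (IsLocalRing.residue (closureValuationSubring (w.adicCompletion F)))).left)).map ζ ≫ (I.univ.fibreBaseChangeIso (pullback.fst (𝓜.localise w).total.hom (specResidueField w)) ((𝓜.localise w).geomReductionMap (thickeningLift e (S.M.obj Kc) y'')).left ≪≫ I.univ.fibreCongrPtIso (((𝓜.localise w).left_geomReductionMap_comp_fst (thickeningLift e (S.M.obj Kc) y'')).trans (Category.assoc _ _ _).symm) ≪≫ (I.univ.fibreBaseChangeIso (extendPoint (closureValuationSubring (w.adicCompletion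 F)) (toClosureValuationSubring w) (𝓜.localise w).total ((𝓜.localise w).modelPointsEquiv.symm (thickeningLift e (S.M.obj Kc) y''))).left ((geomClosedPointIsoSpecResidueField w).inv.left ≫ (specRingHomι (closureValuationSubring (w.adicCompletion F)) (toClosureValuationSubring w) (IsLocalRing.residue (closureValuationSubring (w.adicCompletion F)))).left)).symm).inv.hom.hom.hom) ≫ cbar) =
            ((Over.pullback ((geomClosedPointIsoSpecResidueField w).inv.left ≫ (specRingHomι (closureValuationSubring (w.adicCompletion F)) (toClosureValuationSubring w) (IsLocalRing.residue (closureValuationSubring (w.adicCompletion F)))).left)).map incl ≫ (I.univ.fibreBaseChangeIso (pullback.fst (𝓜.localise w).total.hom (specResidueField w)) ((𝓜.localise w).geomReductionMap (thickeningLift e (S.M.obj Kc) y)).left ≪≫ I.univ.fibreCongrPtIso (((𝓜.localise w).left_geomReductionMap_comp_fst (thickeningLift e (S.M.obj Kc) y)).trans (Category.assoc _ _ _).symm) ≪≫ (I.univ.fibreBaseChangeIso (extendPoint (closureValuationSubring (w.adicCompletion F)) (toClosureValuationSubring w) (𝓜.localise w).total ((𝓜.localise w).modelPointsEquiv.symm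 (thickeningLift e (S.M.obj Kc) y))).left ((geomClosedPointIsoSpecResidueField w).inv.left ≫ (specRingHomι (closureValuationSubring (w.adicCompletion F)) (toClosureValuationSubring w) (IsLocalRing.residue (closureValuationSubring (w.adicCompletion F)))).left)).symm).inv.hom.hom.hom) ≫ ψ)) :
    letI := (𝔡 (red₀Of S Kc 𝓜 w h𝓨 e y)).grp₀
    haveI := (𝔡 (red₀Of S Kc 𝓜 w h𝓨 e y)).aff₀
    letI := (𝔡 (red₀Of S Kc 𝓜 w h𝓨 e y'')).grp₀
    haveI := (𝔡 (red₀Of S Kc 𝓜 w h𝓨 e y'')).aff₀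
    ∀ ⦃T : SchemeOver (geomResidueField w)⦄ (t : T ⟶ (𝔡 (red₀Of S Kc 𝓜 w h𝓨 e y)).G₀),
      ∃ s : T ⟶ specOver (geomResidueField w) (Alg (𝔡 (red₀Of S Kc 𝓜 w h𝓨 e y'')).G₀ ⧸ (spGeoOf I 𝔡 y'' Lb).1),
        s ≫ quotIncl (𝔡 (red₀Of S Kc 𝓜 w h𝓨 e y'')).G₀ (spGeoOf I 𝔡 y'' Lb).1 ≫ (𝔡 (red₀Of S Kc 𝓜 w h𝓨 e y'')).ι₀G ≫ cbar =
          t ≫ (𝔡 (red₀Of S Kc 𝓜 w h𝓨 e y)).ι₀G ≫ ψ := by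
  haveI := I.comm
  haveI : IsProper (𝓜.localise w).total.hom := h𝓨.2
  letI := (toGeomκ w).toAlgebra
  haveI := isMonHom_transR I y
  haveI := isMonHom_transR I y''
  haveI := isAffine_layerR_left I y''
  haveI := isAffine_layerΩ_left I y''
  refine himg_spGeoOf_of_imgLine I 𝔡 y y'' Lb q c ψ cbar
    (baseChangeHom (serreTranslate I.act E' hE' P) (extendPoint (closureValuationSubring (w.adicCompletion F)) (toClosureValuationSubring w) (𝓜.localise w).total
      ((𝓜.localise w).modelPointsEquiv.symm (thickeningLift e (S.M.obj Kc) y''))).left)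
    hσΩ hσκ hσΩ'' hσκ'' hIMG ?_ ?_
  · exact exists_layerΩ_hom_of_roofRows I y y'' Lb q c hLb h2 h2s h4
  · exact isClosedImmersion_quotIncl_ιR_comp_coverR I y'' _ E' hE' P Q hP hQ hQP hPQ h𝔭

set_option maxHeartbeats 400000 in
open scoped MonObj CategoryTheory.Obj in
set_option backward.isDefEq.respectTransparency false in
/-- **§ IMG ASSEMBLED — (ρ1𝒞) (IMG) ROW `himg` AT `H″ := spGeoOf I 𝔡 y″ Lb` FROM THE ROOF ROWS, THE SERRE LETTERS, § Jφ's LINE AND THE (IMG-gen) ROW OF THE REDUCED LEG.**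
For the roof legs `A_y —q→ B ←c— A_{y″}` with (r2) `Ker c(Ω̄) = A_{y″}[𝔭_w]`, `c` onto on points, (r4) common intertwiners; the Serre letters `(E′, P, Q)` of `𝔭_w`; the image line
`Lb : LineOf I y″` with § Jφ's membership law `hLb`; ANY reduced leg `ψ : A_{x̄} → M` and cover `cbar : A_{x̄″} → M` carrying the (IMG-gen) row `hIMG` of ★
`exists_roofLeg_specialFibre_of_downstairsDual_kerRows_image` for `(q, c)` ((b″) text, closed-immersion instance at the MODEL cover `ψ_P ×_𝓨 ỹ″`): for every `T`-point
`t` of the dock `G₀(x̄)` there is `s : T → V(H″)` with `s ≫ V(H″) ↪ G₀(x̄″) ↪ A_{x̄″} —cbar→ = t ≫ G₀(x̄) ↪ A_{x̄} —ψ→`.  = g36's `himg_spGeoOf_of_imgLine` with (F1) by LS ED. 3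
`iso…Of_inv_eq_fibreAlongIso`, `himgΩ` by (U1″) `exists_layerΩ_hom_of_roofRows`, `hclosed` by (T1-LS) `isClosedImmersion_quotIncl_ιR_comp_coverR`.
[cite: Liu2021, Prop. D.8 (1)(2) p. 135, p. 137] [cite: SerreTate1968, §1 Lemma 2] [cite: EGAIV2, Prop. 2.8.5] [cite: Tate1997FiniteFlatGroupSchemes, (3.7)]
[cite: GortzWedhorn2020, Cor. 12.92 and Prop. 12.94] -/
theorem himg_spGeoOf_of_roofRows [ExpChar (geomResidueField w) I.pChar] (𝔡 : ∀ xbar, DockAt I xbar)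
    (y y'' : AlgPoints (S.M.obj Kc) (AlgebraicClosure (w.adicCompletion F))) (Lb : LineOf I y'')
    {B : AbelianSchemeOver (Spec (.of (AlgebraicClosure (w.adicCompletion F))))}
    (q : (schΩOf S Kc 𝓜 w e I.univ y).X ⟶ B.X) [IsMonHom q] (c : (schΩOf S Kc 𝓜 w e I.univ y'').X ⟶ B.X) [IsMonHom c]
    -- downstairs: `ψ` the reduced leg and `cbar` (in (ρ1𝒞): `c̄_{x̄″}`) into ANY `M`
    {M : SchemeOver (geomResidueField w)}
    (ψ : (sch₀Of 𝓜 w I.univ (red₀Of S Kc 𝓜 w h𝓨 e y)).X ⟶ M) (cbar : (sch₀Of 𝓜 w I.univ (red₀Of S Kc 𝓜 w h𝓨 e y'')).X ⟶ M)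
    -- the Serre letters of `𝔭_w` (the (ρ1𝒞) socket's, VERBATIM)
    {m : ℕ} (E' : Matrix (Fin m) (Fin m) (𝓞 F)) (hE' : E' * E' = E') (P : Matrix (Fin m) (Fin 1) (𝓞 F)) (Q : Matrix (Fin 1) (Fin m) (𝓞 F))
    (hP : E' * P = P) (hQ : Q * E' = Q) (hQP : Q * P = Matrix.scalar (Fin 1) (I.pChar : 𝓞 F))
    (hPQ : P * Q = Matrix.scalar (Fin m) (I.pChar : 𝓞 F) * E') (h𝔭 : Ideal.span (Set.range fun k => P k 0) = w.asIdeal)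
    -- § Jφ's membership law (B-p08 `mem_imgLineOfRoof_iff` text)
    (hLb : ∀ P'' : (fibreΩOf S Kc 𝓜 w e I.univ y'').Points (AlgebraicClosure (w.adicCompletion F)),
      P'' ∈ Lb.1 ↔
        IsIdealTorsionΩ S Kc 𝓜 w e I.univ I.act y'' ((IsCMField.complexConj F) • w).asIdeal P'' ∧
          ∃ P : (fibreΩOf S Kc 𝓜 w e I.univ y).Points (AlgebraicClosure (w.adicCompletion F)),
            IsIdealTorsionΩ S Kc 𝓜 w e I.univ I.act y ((IsCMField.complexConj F) • w).asIdeal P ∧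
              (AlgPoints.map c P'' : B.toAffine.toAbelianVariety.Points (AlgebraicClosure (w.adicCompletion F))) = AlgPoints.map q P)
    -- (r2) `Ker c(Ω̄) = A_{y″}[𝔭_w]` (the legs' `hr2` text)
    (h2 : ∀ P : (fibreΩOf S Kc 𝓜 w e I.univ y'').Points (AlgebraicClosure (w.adicCompletion F)),
      (AlgPoints.map c P : B.toAffine.toAbelianVariety.Points (AlgebraicClosure (w.adicCompletion F))) = 1 ↔
        IsIdealTorsionΩ S Kc 𝓜 w e I.univ I.act y'' w.asIdeal P)
    -- `c` is onto on points
    (h2s : Function.Surjective c.left.base)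
    -- (r4) common intertwiners of the legs (the legs' `hr4` text)
    (h4 : ∀ a : 𝓞 F, ∃ b : B.X ⟶ B.X,
      (actΩOf S Kc 𝓜 w e I.univ I.act a y).hom.hom.hom ≫ q = q ≫ b ∧ (actΩOf S Kc 𝓜 w e I.univ I.act a y'').hom.hom.hom ≫ c = c ≫ b)
    -- the (IMG-gen) row of ★ `exists_roofLeg_specialFibre_of_downstairsDual_kerRows_image` for `ψ` ((b″) `exists_roofLeg_of_legs_kerRows_image` last conjunct, TOKEN FOR TOKEN)
    (hIMG : haveI := I.comm; haveI : IsProper (𝓜.localise w).total.hom := h𝓨.2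
      (∀ (𝒦 : Over (Spec (.of (closureValuationSubring (w.adicCompletion F))))) (incl : 𝒦 ⟶ (I.univ.baseChange (extendPoint (closureValuationSubring (w.adicCompletion F)) (toClosureValuationSubring w) (𝓜.localise w).total ((𝓜.localise w).modelPointsEquiv.symm (thickeningLift e (S.M.obj Kc) y))).left).X) [Flat 𝒦.hom]
        (𝒵 : Over (Spec (.of (closureValuationSubring (w.adicCompletion F))))) (ζ : 𝒵 ⟶ (I.univ.baseChange (extendPoint (closureValuationSubring (w.adicCompletion F)) (toClosureValuationSubring w) (𝓜.localise w).total ((𝓜.localise w).modelPointsEquiv.symm (thickeningLift e (S.M.obj Kc) y''))).left).X) [IsClosedImmersion (ζ ≫ baseChangeHom (serreTranslate I.act E' hE' P) (extendPoint (closureValuationSubring (w.adicCompletion F)) (toClosureValuationSubring w) (𝓜.localise w).total ((𝓜.localise w).modelPointsEquiv.symm (thickeningLift e (S.M.obj Kc) y''))).left).left],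
        (∃ m : (Over.pullback (specFractionFieldι (closureValuationSubring (w.adicCompletion F)) (toClosureValuationSubring w)).left).obj 𝒦 ⟶ (Over.pullback (specFractionFieldι (closureValuationSubring (w.adicCompletion F)) (toClosureValuationSubring w)).left).obj 𝒵,
          m ≫ (((Over.pullback (specFractionFieldι (closureValuationSubring (w.adicCompletion F)) (toClosureValuationSubring w)).left).map ζ ≫ (I.univ.fibreBaseChangeIso ((𝓜.localise w).genericIso'.inv.left ≫ pullback.fst (𝓜.localise w).total.hom (specGenericPoint (HeightOneSpectrum.valuationSubringAtPrime F w) F)) (thickeningLift e (S.M.obj Kc) y'').left ≪≫ I.univ.fibreCongrPtIso ((𝓜.localise w).left_specFractionFieldι_comp_extendPoint_modelPointsEquiv_symm (thickeningLift e (S.M.obj Kc) y'')).symm ≪≫ (I.univ.fibreBaseChangeIso (extendPoint (closureValuationSubring (w.adicCompletion F)) (toClosureValuationSubring w) (𝓜.localise w).total ((𝓜.localise w).modelPointsEquiv.symm (thickeningLift e (S.M.obj Kc) y''))).left (specFractionFieldι (closureValuationSubring (w.adicCompletion F)) (toClosureValuationSubring w)).left).symm).inv.hom.hom.hom) ≫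 c) =
            ((Over.pullback (specFractionFieldι (closureValuationSubring (w.adicCompletion F)) (toClosureValuationSubring w)).left).map incl ≫ (I.univ.fibreBaseChangeIso ((𝓜.localise w).genericIso'.inv.left ≫ pullback.fst (𝓜.localise w).total.hom (specGenericPoint (HeightOneSpectrum.valuationSubringAtPrime F w) F)) (thickeningLift e (S.M.obj Kc) y).left ≪≫ I.univ.fibreCongrPtIso ((𝓜.localise w).left_specFractionFieldι_comp_extendPoint_modelPointsEquiv_symm (thickeningLift e (S.M.obj Kc) y)).symm ≪≫ (I.univ.fibreBaseChangeIso (extendPoint (closureValuationSubring (w.adicCompletion F)) (toClosureValuationSubring w) (𝓜.localise w).total ((𝓜.localise w).modelPointsEquiv.symm (thickeningLift e (S.M.obj Kc) y))).left (specFractionFieldι (closureValuationSubring (w.adicCompletion F)) (toClosureValuationSubring w)).left).symm).inv.hom.hom.hom) ≫ q) →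
        ∃ m : (Over.pullback ((geomClosedPointIsoSpecResidueField w).inv.left ≫ (specRingHomι (closureValuationSubring (w.adicCompletion F)) (toClosureValuationSubring w) (IsLocalRing.residue (closureValuationSubring (w.adicCompletion F)))).left)).obj 𝒦 ⟶ (Over.pullback ((geomClosedPointIsoSpecResidueField w).inv.left ≫ (specRingHomι (closureValuationSubring (w.adicCompletion F)) (toClosureValuationSubring w) (IsLocalRing.residue (closureValuationSubring (w.adicCompletion F)))).left)).obj 𝒵,
          m ≫ (((Over.pullback ((geomClosedPointIsoSpecResidueField w).inv.left ≫ (specRingHomι (closureValuationSubring (w.adicCompletion F)) (toClosureValuationSubring w) (IsLocalRing.residue (closureValuationSubring (w.adicCompletion F)))).left)).map ζ ≫ (I.univ.fibreBaseChangeIso (pullback.fst (𝓜.localise w).total.hom (specResidueField w)) ((𝓜.localise w).geomReductionMap (thickeningLift e (S.M.obj Kc) y'')).left ≪≫ I.univ.fibreCongrPtIso (((𝓜.localise w).left_geomReductionMap_comp_fst (thickeningLift e (S.M.obj Kc) y'')).trans (Category.assoc _ _ _).symm) ≪≫ (I.univ.fibreBaseChangeIso (extendPoint (closureValuationSubring (w.adicCompletion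 F)) (toClosureValuationSubring w) (𝓜.localise w).total ((𝓜.localise w).modelPointsEquiv.symm (thickeningLift e (S.M.obj Kc) y''))).left ((geomClosedPointIsoSpecResidueField w).inv.left ≫ (specRingHomι (closureValuationSubring (w.adicCompletion F)) (toClosureValuationSubring w) (IsLocalRing.residue (closureValuationSubring (w.adicCompletion F)))).left)).symm).inv.hom.hom.hom) ≫ cbar) =
            ((Over.pullback ((geomClosedPointIsoSpecResidueField w).inv.left ≫ (specRingHomι (closureValuationSubring (w.adicCompletion F)) (toClosureValuationSubring w) (IsLocalRing.residue (closureValuationSubring (w.adicCompletion F)))).left)).map incl ≫ (I.univ.fibreBaseChangeIso (pullback.fst (𝓜.localise w).total.hom (specResidueField w)) ((𝓜.localise w).geomReductionMap (thickeningLift e (S.M.obj Kc) y)).left ≪≫ I.univ.fibreCongrPtIso (((𝓜.localise w).left_geomReductionMap_comp_fst (thickeningLift e (S.M.obj Kc) y)).trans (Category.assoc _ _ _).symm) ≪≫ (I.univ.fibreBaseChangeIso (extendPoint (closureValuationSubring (w.adicCompletion F)) (toClosureValuationSubring w) (𝓜.localise w).total ((𝓜.localise w).modelPointsEquiv.symm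 (thickeningLift e (S.M.obj Kc) y))).left ((geomClosedPointIsoSpecResidueField w).inv.left ≫ (specRingHomι (closureValuationSubring (w.adicCompletion F)) (toClosureValuationSubring w) (IsLocalRing.residue (closureValuationSubring (w.adicCompletion F)))).left)).symm).inv.hom.hom.hom) ≫ ψ)) :
    letI := (𝔡 (red₀Of S Kc 𝓜 w h𝓨 e y)).grp₀
    haveI := (𝔡 (red₀Of S Kc 𝓜 w h𝓨 e y)).aff₀
    letI := (𝔡 (red₀Of S Kc 𝓜 w h𝓨 e y'')).grp₀
    haveI := (𝔡 (red₀Of S Kc 𝓜 w h𝓨 e y'')).aff₀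
    ∀ ⦃T : SchemeOver (geomResidueField w)⦄ (t : T ⟶ (𝔡 (red₀Of S Kc 𝓜 w h𝓨 e y)).G₀),
      ∃ s : T ⟶ specOver (geomResidueField w) (Alg (𝔡 (red₀Of S Kc 𝓜 w h𝓨 e y'')).G₀ ⧸ (spGeoOf I 𝔡 y'' Lb).1),
        s ≫ quotIncl (𝔡 (red₀Of S Kc 𝓜 w h𝓨 e y'')).G₀ (spGeoOf I 𝔡 y'' Lb).1 ≫ (𝔡 (red₀Of S Kc 𝓜 w h𝓨 e y'')).ι₀G ≫ cbar =
          t ≫ (𝔡 (red₀Of S Kc 𝓜 w h𝓨 e y)).ι₀G ≫ ψ := by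
  haveI := I.comm
  haveI : IsProper (𝓜.localise w).total.hom := h𝓨.2
  letI := (toGeomκ w).toAlgebra
  haveI := isMonHom_transR I y
  haveI := isMonHom_transR I y''
  haveI := isAffine_layerR_left I y''
  haveI := isAffine_layerΩ_left I y''
  refine himg_spGeoOf_of_imgLine I 𝔡 y y'' Lb q c ψ cbar
    (baseChangeHom (serreTranslate I.act E' hE' P) (extendPoint (closureValuationSubring (w.adicCompletion F)) (toClosureValuationSubring w) (𝓜.localise w).total
      ((𝓜.localise w).modelPointsEquiv.symm (thickeningLift e (S.M.obj Kc) y''))).left)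
    ?_ ?_ ?_ ?_ hIMG ?_ ?_
  · exact isoGenericOf_inv_eq_fibreAlongIso I y
  · exact isoSpecialOf_inv_eq_fibreAlongIso I y
  · exact isoGenericOf_inv_eq_fibreAlongIso I y''
  · exact isoSpecialOf_inv_eq_fibreAlongIso I y''
  · exact exists_layerΩ_hom_of_roofRows I y y'' Lb q c hLb h2 h2s h4
  · exact isClosedImmersion_quotIncl_ιR_comp_coverR I y'' _ E' hE' P Q hP hQ hQP hPQ h𝔭

set_option maxHeartbeats 400000 in
open scoped MonObj CategoryTheory.Obj in
set_option backward.isDefEq.respectTransparency false in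
/-- **`row_IMG` SHAPE — the (IMG) conjunct of `exists_quotLegReduction_of_legs` REPACKAGED**: from § J's output «there is a line `Lb` at `y″` with the image-line
membership law AND the clause `ρ Lb`» (B-p08 `imgLine_quotΩ_quotΩ_eq_translΩ_assembled`: `ρ Lb := (quotΩ (quotΩ y L) Lb = translΩ y)`, membership = `mem_imgLineOfRoof_iff`
= `Iff.rfl`) and the inputs of `himg_spGeoOf_of_roofRows_of_sigma`, the row `∃ Lb, ρ Lb ∧ himg(Lb)` with the dock instances spelled as in the socket.
[cite: Liu2021, Prop. D.8 (1)(2) p. 135, p. 137] -/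
theorem row_IMG_of_sigma [ExpChar (geomResidueField w) I.pChar] (𝔡 : ∀ xbar, DockAt I xbar)
    (y y'' : AlgPoints (S.M.obj Kc) (AlgebraicClosure (w.adicCompletion F))) (ρ : LineOf I y'' → Prop)
    {B : AbelianSchemeOver (Spec (.of (AlgebraicClosure (w.adicCompletion F))))}
    (q : (schΩOf S Kc 𝓜 w e I.univ y).X ⟶ B.X) [IsMonHom q] (c : (schΩOf S Kc 𝓜 w e I.univ y'').X ⟶ B.X) [IsMonHom c]
    {M : SchemeOver (geomResidueField w)}
    (ψ : (sch₀Of 𝓜 w I.univ (red₀Of S Kc 𝓜 w h𝓨 e y)).X ⟶ M) (cbar : (sch₀Of 𝓜 w I.univ (red₀Of S Kc 𝓜 w h𝓨 e y'')).X ⟶ M)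
    {m : ℕ} (E' : Matrix (Fin m) (Fin m) (𝓞 F)) (hE' : E' * E' = E') (P : Matrix (Fin m) (Fin 1) (𝓞 F)) (Q : Matrix (Fin 1) (Fin m) (𝓞 F))
    (hP : E' * P = P) (hQ : Q * E' = Q) (hQP : Q * P = Matrix.scalar (Fin 1) (I.pChar : 𝓞 F))
    (hPQ : P * Q = Matrix.scalar (Fin m) (I.pChar : 𝓞 F) * E') (h𝔭 : Ideal.span (Set.range fun k => P k 0) = w.asIdeal)
    -- § J's output: a line with the image-line membership law and the clause `ρ`
    (hJ : ∃ Lb : LineOf I y'',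
      (∀ P'' : (fibreΩOf S Kc 𝓜 w e I.univ y'').Points (AlgebraicClosure (w.adicCompletion F)),
        P'' ∈ Lb.1 ↔
          IsIdealTorsionΩ S Kc 𝓜 w e I.univ I.act y'' ((IsCMField.complexConj F) • w).asIdeal P'' ∧
            ∃ P : (fibreΩOf S Kc 𝓜 w e I.univ y).Points (AlgebraicClosure (w.adicCompletion F)),
              IsIdealTorsionΩ S Kc 𝓜 w e I.univ I.act y ((IsCMField.complexConj F) • w).asIdeal P ∧
                (AlgPoints.map c P'' : B.toAffine.toAbelianVariety.Points (AlgebraicClosure (w.adicCompletion F))) = AlgPoints.map q P) ∧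
      ρ Lb)
    (h2 : ∀ P : (fibreΩOf S Kc 𝓜 w e I.univ y'').Points (AlgebraicClosure (w.adicCompletion F)),
      (AlgPoints.map c P : B.toAffine.toAbelianVariety.Points (AlgebraicClosure (w.adicCompletion F))) = 1 ↔
        IsIdealTorsionΩ S Kc 𝓜 w e I.univ I.act y'' w.asIdeal P)
    (h2s : Function.Surjective c.left.base)
    (h4 : ∀ a : 𝓞 F, ∃ b : B.X ⟶ B.X,
      (actΩOf S Kc 𝓜 w e I.univ I.act a y).hom.hom.hom ≫ q = q ≫ b ∧ (actΩOf S Kc 𝓜 w e I.univ I.act a y'').hom.hom.hom ≫ c = c ≫ b)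
    -- (F1) at `y` and `y″` (KILL engine binder texts VERBATIM; on LS ED. 3: `iso…Of_inv_eq_fibreAlongIso`, see `himg_spGeoOf_of_roofRows`)
    (hσΩ : (isoGenericOf I y).inv =
      (I.univ.fibreBaseChangeIso ((𝓜.localise w).genericIso'.inv.left ≫ pullback.fst (𝓜.localise w).total.hom (specGenericPoint (HeightOneSpectrum.valuationSubringAtPrime F w) F))
          (thickeningLift e (S.M.obj Kc) y).left ≪≫
        I.univ.fibreCongrPtIso (left_thickeningLift_comp_genericι_eq S Kc 𝓜 w h𝓨 e y) ≪≫
        (I.univ.fibreBaseChangeIso (liftOf S Kc 𝓜 w h𝓨 e y).left (sΩ w)).symm).inv.hom.hom.hom)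
    (hσκ : (isoSpecialOf I y).inv =
      (I.univ.fibreBaseChangeIso (pullback.fst (𝓜.localise w).total.hom (specResidueField w)) (red₀Of S Kc 𝓜 w h𝓨 e y).left ≪≫
        I.univ.fibreCongrPtIso (left_red₀Of_comp_specialι_eq S Kc 𝓜 w h𝓨 e y) ≪≫
        (I.univ.fibreBaseChangeIso (liftOf S Kc 𝓜 w h𝓨 e y).left (sκ w)).symm).inv.hom.hom.hom)
    (hσΩ'' : (isoGenericOf I y'').inv =
      (I.univ.fibreBaseChangeIso ((𝓜.localise w).genericIso'.inv.left ≫ pullback.fst (𝓜.localise w).total.hom (specGenericPoint (HeightOneSpectrum.valuationSubringAtPrime F w) F))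
          (thickeningLift e (S.M.obj Kc) y'').left ≪≫
        I.univ.fibreCongrPtIso (left_thickeningLift_comp_genericι_eq S Kc 𝓜 w h𝓨 e y'') ≪≫
        (I.univ.fibreBaseChangeIso (liftOf S Kc 𝓜 w h𝓨 e y'').left (sΩ w)).symm).inv.hom.hom.hom)
    (hσκ'' : (isoSpecialOf I y'').inv =
      (I.univ.fibreBaseChangeIso (pullback.fst (𝓜.localise w).total.hom (specResidueField w)) (red₀Of S Kc 𝓜 w h𝓨 e y'').left ≪≫
        I.univ.fibreCongrPtIso (left_red₀Of_comp_specialι_eq S Kc 𝓜 w h𝓨 e y'') ≪≫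
        (I.univ.fibreBaseChangeIso (liftOf S Kc 𝓜 w h𝓨 e y'').left (sκ w)).symm).inv.hom.hom.hom)    (hIMG : haveI := I.comm; haveI : IsProper (𝓜.localise w).total.hom := h𝓨.2
      (∀ (𝒦 : Over (Spec (.of (closureValuationSubring (w.adicCompletion F))))) (incl : 𝒦 ⟶ (I.univ.baseChange (extendPoint (closureValuationSubring (w.adicCompletion F)) (toClosureValuationSubring w) (𝓜.localise w).total ((𝓜.localise w).modelPointsEquiv.symm (thickeningLift e (S.M.obj Kc) y))).left).X) [Flat 𝒦.hom]
        (𝒵 : Over (Spec (.of (closureValuationSubring (w.adicCompletion F))))) (ζ : 𝒵 ⟶ (I.univ.baseChange (extendPoint (closureValuationSubring (w.adicCompletion F)) (toClosureValuationSubring w) (𝓜.localise w).total ((𝓜.localise w).modelPointsEquiv.symm (thickeningLift e (S.M.obj Kc) y''))).left).X) [IsClosedImmersion (ζ ≫ baseChangeHom (serreTranslate I.act E' hE' P) (extendPoint (closureValuationSubring (w.adicCompletion F)) (toClosureValuationSubring w) (𝓜.localise w).total ((𝓜.localise w).modelPointsEquiv.symm (thickeningLift e (S.M.obj Kc) y'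'))).left).left],
        (∃ m : (Over.pullback (specFractionFieldι (closureValuationSubring (w.adicCompletion F)) (toClosureValuationSubring w)).left).obj 𝒦 ⟶ (Over.pullback (specFractionFieldι (closureValuationSubring (w.adicCompletion F)) (toClosureValuationSubring w)).left).obj 𝒵,
          m ≫ (((Over.pullback (specFractionFieldι (closureValuationSubring (w.adicCompletion F)) (toClosureValuationSubring w)).left).map ζ ≫ (I.univ.fibreBaseChangeIso ((𝓜.localise w).genericIso'.inv.left ≫ pullback.fst (𝓜.localise w).total.hom (specGenericPoint (HeightOneSpectrum.valuationSubringAtPrime F w) F)) (thickeningLift e (S.M.obj Kc) y'').left ≪≫ I.univ.fibreCongrPtIso ((𝓜.localise w).left_specFractionFieldι_comp_extendPoint_modelPointsEquiv_symm (thickeningLift e (S.M.obj Kc) y'')).symm ≪≫ (I.univ.fibreBaseChangeIso (extendPoint (closureValuationSubring (w.adicCompletion F)) (toClosureValuationSubring w) (𝓜.localise w).total ((𝓜.localise w).modelPointsEquiv.symm (thickeningLift e (S.M.obj Kc) y''))).left (specFractionFieldι (closureValuationSubring (w.adicCompletion F)) (toClosureValuationSubring w)).left).symm).inv.hom.hom.hom)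 ≫ c) =
            ((Over.pullback (specFractionFieldι (closureValuationSubring (w.adicCompletion F)) (toClosureValuationSubring w)).left).map incl ≫ (I.univ.fibreBaseChangeIso ((𝓜.localise w).genericIso'.inv.left ≫ pullback.fst (𝓜.localise w).total.hom (specGenericPoint (HeightOneSpectrum.valuationSubringAtPrime F w) F)) (thickeningLift e (S.M.obj Kc) y).left ≪≫ I.univ.fibreCongrPtIso ((𝓜.localise w).left_specFractionFieldι_comp_extendPoint_modelPointsEquiv_symm (thickeningLift e (S.M.obj Kc) y)).symm ≪≫ (I.univ.fibreBaseChangeIso (extendPoint (closureValuationSubring (w.adicCompletion F)) (toClosureValuationSubring w) (𝓜.localise w).total ((𝓜.localise w).modelPointsEquiv.symm (thickeningLift e (S.M.obj Kc) y))).left (specFractionFieldι (closureValuationSubring (w.adicCompletion F)) (toClosureValuationSubring w)).left).symm).inv.hom.hom.hom) ≫ q) →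
        ∃ m : (Over.pullback ((geomClosedPointIsoSpecResidueField w).inv.left ≫ (specRingHomι (closureValuationSubring (w.adicCompletion F)) (toClosureValuationSubring w) (IsLocalRing.residue (closureValuationSubring (w.adicCompletion F)))).left)).obj 𝒦 ⟶ (Over.pullback ((geomClosedPointIsoSpecResidueField w).inv.left ≫ (specRingHomι (closureValuationSubring (w.adicCompletion F)) (toClosureValuationSubring w) (IsLocalRing.residue (closureValuationSubring (w.adicCompletion F)))).left)).obj 𝒵,
          m ≫ (((Over.pullback ((geomClosedPointIsoSpecResidueField w).inv.left ≫ (specRingHomι (closureValuationSubring (w.adicCompletion F)) (toClosureValuationSubring w) (IsLocalRing.residue (closureValuationSubring (w.adicCompletion F)))).left)).map ζ ≫ (I.univ.fibreBaseChangeIso (pullback.fst (𝓜.localise w).total.hom (specResidueField w)) ((𝓜.localise w).geomReductionMap (thickeningLift e (S.M.obj Kc) y'')).left ≪≫ I.univ.fibreCongrPtIso (((𝓜.localise w).left_geomReductionMap_comp_fst (thickeningLift e (S.M.obj Kc) y'')).trans (Category.assoc _ _ _).symm) ≪≫ (I.univ.fibreBaseChangeIso (extendPoint (closureValuationSubring (w.adicCompletion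 F)) (toClosureValuationSubring w) (𝓜.localise w).total ((𝓜.localise w).modelPointsEquiv.symm (thickeningLift e (S.M.obj Kc) y''))).left ((geomClosedPointIsoSpecResidueField w).inv.left ≫ (specRingHomι (closureValuationSubring (w.adicCompletion F)) (toClosureValuationSubring w) (IsLocalRing.residue (closureValuationSubring (w.adicCompletion F)))).left)).symm).inv.hom.hom.hom) ≫ cbar) =
            ((Over.pullback ((geomClosedPointIsoSpecResidueField w).inv.left ≫ (specRingHomι (closureValuationSubring (w.adicCompletion F)) (toClosureValuationSubring w) (IsLocalRing.residue (closureValuationSubring (w.adicCompletion F)))).left)).map incl ≫ (I.univ.fibreBaseChangeIso (pullback.fst (𝓜.localise w).total.hom (specResidueField w)) ((𝓜.localise w).geomReductionMap (thickeningLift e (S.M.obj Kc) y)).left ≪≫ I.univ.fibreCongrPtIso (((𝓜.localise w).left_geomReductionMap_comp_fst (thickeningLift e (S.M.obj Kc) y)).trans (Category.assoc _ _ _).symm) ≪≫ (I.univ.fibreBaseChangeIso (extendPoint (closureValuationSubring (w.adicCompletion F)) (toClosureValuationSubring w) (𝓜.localise w).total ((𝓜.localise w).modelPointsEquiv.symm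 (thickeningLift e (S.M.obj Kc) y))).left ((geomClosedPointIsoSpecResidueField w).inv.left ≫ (specRingHomι (closureValuationSubring (w.adicCompletion F)) (toClosureValuationSubring w) (IsLocalRing.residue (closureValuationSubring (w.adicCompletion F)))).left)).symm).inv.hom.hom.hom) ≫ ψ)) :
    ∃ Lb : LineOf I y'', ρ Lb ∧
      (letI := (𝔡 (red₀Of S Kc 𝓜 w h𝓨 e y'')).grp₀; haveI := (𝔡 (red₀Of S Kc 𝓜 w h𝓨 e y'')).aff₀;
        ∀ ⦃T : SchemeOver (geomResidueField w)⦄ (t : T ⟶ (𝔡 (red₀Of S Kc 𝓜 w h𝓨 e y)).G₀),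
          ∃ s : T ⟶ specOver (geomResidueField w) (Alg (𝔡 (red₀Of S Kc 𝓜 w h𝓨 e y'')).G₀ ⧸ (spGeoOf I 𝔡 y'' Lb).1),
            s ≫ quotIncl (𝔡 (red₀Of S Kc 𝓜 w h𝓨 e y'')).G₀ (spGeoOf I 𝔡 y'' Lb).1 ≫ (𝔡 (red₀Of S Kc 𝓜 w h𝓨 e y'')).ι₀G ≫ cbar =
              t ≫ (𝔡 (red₀Of S Kc 𝓜 w h𝓨 e y)).ι₀G ≫ ψ) :=
  hJ.elim fun Lb hLb => ⟨Lb, hLb.2, fun _ t =>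
    himg_spGeoOf_of_roofRows_of_sigma I 𝔡 y y'' Lb q c ψ cbar E' hE' P Q hP hQ hQP hPQ h𝔭 hLb.1 h2 h2s h4 hσΩ hσκ hσΩ'' hσκ'' hIMG t⟩

end ImgRowAssembled

end Summit.HodgeConjecture.HodgeConjecture.Cruxes.HLiu418.F0P6aLineSpecialisation

end
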